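import Literature.MathematicalPhysics.QuantumFieldTheory.TphiSeminormTaylor
import Literature.MathematicalPhysics.QuantumFieldTheory.TphiSeminormGaussianConvolution
import Literature.Analysis.Matrix.RegulatorSubcriticality
import HarnessLib

/-!
# The fluctuation step in the regulated `T_φ`-seminorm: smoothness and Taylor-remainder contraction

The two estimates of Bauerschmidt–Brydges–Slade §7.3–7.5 (`TphiSeminormExpectation`,
`TphiSeminormTaylor`) combined with a Gaussian regulator (`TphiSeminormGaussianConvolution`):

* `DerivDominated.contDiff_integral` — a parametrised integral with locally dominated derivatives
  of orders `≤ N` is `C^N` (continuity by dominated convergence, differentiability by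
  `hasFDerivAt_integral_of_dominated_of_fderiv_le`); in particular the Gaussian convolution
  `𝔼θF = ∫ F(· + ζ) N(0,S)(dζ)` of a regulator-bounded `C^N` functional is `C^N`
  (`contDiff_gaussian_convolution`);
* `tphiSeminorm_le_of_tzero_of_regulator` — the regulated form of BBS Corollary 7.5.4: if
  `‖F‖_{T_ψ(h)} ≤ A·G(ψ)` with a regulator that is monotone along rays (`G(tψ) ≤ G(ψ)`, `0 ≤ t ≤ 1`;
  e.g. `G = e^{½ψᵀMψ}`, `M ⪰ 0`), then for `k < N`, `0 < ℓ ≤ h`,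
  `‖F‖_{T_φ(ℓ)} ≤ P_ℓ(φ)^{k+1} (‖F‖_{T_0(ℓ)} + 2(ℓ/h)^{k+1} A G(φ))`;
* `tphiSeminorm_taylorRemainder_gaussian_convolution_le` — **the contraction mechanism of the
  renormalisation group step** ("crucial contraction", BBS §7.5/§10.5): after integrating out
  `ζ ∼ N(0,S)` against a functional with `‖F‖_{T_x(𝔥)} ≤ A e^{½xᵀMx}` (regulator `M ⪰ 0` with a
  margin `t > 1`, `1 − √S(tM)√S ≻ 0`), the Taylor remainder beyond degree `k < N` measured at the
  smaller field unit `ℓ ≤ 𝔥` is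
  `‖(1 − Tay_k) 𝔼θF‖_{T_φ(ℓ)} ≤ 2 (ℓ/𝔥)^{k+1} P_ℓ(φ)^{k+1} · A e^{½ φᵀM₊φ}/√det(1 − SM)`,
  `M₊ = M(1 − SM)⁻¹ ⪰ 0` the renormalised regulator.

Also an adapter between the additive margin `(1−ε)·1 − √S M √S ⪰ 0` of
`Literature/Analysis/Matrix/RegulatorSubcriticality` and the multiplicative margin used here.

Context: single-regime RG for crux `BalabanIR.BirComplexStableXYR` (Hubbard summit), line
`fat-gaussian-defect-calculus`, T-RG.

## References

* R. Bauerschmidt, D. C. Brydges, G. Slade, *Introduction to a Renormalisation Group Method*,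
  LNM 2242 (2019), Prop. 7.3.1, Lemma 7.5.3, Cor. 7.5.4, §10.5. [BauerschmidtBrydgesSlade2019RG]
-/

noncomputable section

namespace Literature.MathematicalPhysics.QuantumFieldTheory

open MeasureTheory ProbabilityTheory Matrix WithLp Set Metric Finset Filter Topology
open scoped MatrixOrder
open Literature.Probability.Distributions Literature.Analysis.Matrix
open Literature.MathematicalPhysics.QuantumFieldTheory.GaussianToolkit

/-! ### Smoothness of dominated parametrised integrals -/

section Smooth

variable {E : Type*} [NormedAddCommGroup E] [NormedSpace ℝ E]
variable {A : Type*} [NormedRing A] [NormedAlgebra ℝ A] [CompleteSpace A]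
variable {Z : Type*} [MeasurableSpace Z] {μ : Measure Z}

/-- **A parametrised integral with locally dominated derivatives is `C^N`.** Under
`DerivDominated N F μ`, `y ↦ ∫ F(y,ζ) dμ(ζ)` is of class `C^N`: its derivatives of orders `≤ N` are
the integrals of the derivatives (`DerivDominated.iteratedFDeriv_integral_eq`), continuous by
dominated convergence, and differentiable below order `N` by dominated differentiation.
[cite: BauerschmidtBrydgesSlade2019RG, Prop. 7.3.1] -/
theorem DerivDominated.contDiff_integral {N : ℕ} {F : E → Z → A} (h : DerivDominated N F μ) :
    ContDiff ℝ N (fun y => ∫ z, F y z ∂μ) := by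
  rw [show ((N : ℕ) : WithTop ℕ∞) = ((N : ℕ∞) : WithTop ℕ∞) from (WithTop.coe_natCast N).symm,
    contDiff_iff_continuous_differentiable]
  refine ⟨fun m hm => ?_, fun m hm => ?_⟩
  · have hm' : m ≤ N := by exact_mod_cast hm
    have heq : (fun y => iteratedFDeriv ℝ m (fun y => ∫ z, F y z ∂μ) y) =
        fun y => ∫ z, iteratedFDeriv ℝ m (fun y => F y z) y ∂μ := funext (h.iteratedFDeriv_integral_eq m hm')
    rw [heq]
    refine continuous_iff_continuousAt.2 fun x₀ => ?_
    obtain ⟨bound, hbi, ε, hε, hb⟩ := h.bound m hm' x₀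
    refine continuousAt_of_dominated (Eventually.of_forall fun y => h.meas m hm' y) ?_ hbi ?_
    · filter_upwards [ball_mem_nhds x₀ hε] with y hy
      filter_upwards [hb] with z hz
      exact hz y hy
    · exact ae_of_all _ fun z =>
        ((h.contDiff z).continuous_iteratedFDeriv (by exact_mod_cast hm')).continuousAt
  · have hm' : m + 1 ≤ N := by exact_mod_cast (show (m : ℕ∞) < N from hm)
    have hmN : m ≤ N := Nat.le_of_succ_le hm'
    have heq : (fun y => iteratedFDeriv ℝ m (fun y => ∫ z, F y z ∂μ) y) =
        fun y => ∫ z, iteratedFDeriv ℝ m (fun y => F y z) y ∂μ := funext (h.iteratedFDeriv_integral_eq m hmN)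
    rw [heq]
    intro x
    set G' : E → Z → (E →L[ℝ] E [×m]→L[ℝ] A) := fun y z => fderiv ℝ (iteratedFDeriv ℝ m (fun y => F y z)) y
      with hG'
    obtain ⟨bound, hbi, ε, hε, hb⟩ := h.bound (m + 1) hm' x
    have hderiv : HasFDerivAt (fun y => ∫ z, iteratedFDeriv ℝ m (fun y => F y z) y ∂μ) (∫ z, G' x z ∂μ) x := by
      refine hasFDerivAt_integral_of_dominated_of_fderiv_le (F' := G') (bound := bound) (ball_mem_nhds x hε)
        (Eventually.of_forall fun y => h.meas m hmN y) (h.integrable hmN x) ?_ ?_ hbi ?_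
      · have e : G' x = fun z => (continuousMultilinearCurryLeftEquiv ℝ (fun _ : Fin (m + 1) => E) A)
            (iteratedFDeriv ℝ (m + 1) (fun y => F y z) x) := by
          funext z; simp only [hG']; rw [fderiv_iteratedFDeriv]; rfl
        rw [e]
        exact (continuousMultilinearCurryLeftEquiv ℝ (fun _ : Fin (m + 1) => E) A).continuous.comp_aestronglyMeasurable
          (h.meas (m + 1) hm' x)
      · filter_upwards [hb] with z hz y hy
        simp only [hG']
        rw [norm_fderiv_iteratedFDeriv]
        exact hz y hy
      · exact ae_of_all _ fun z y _ =>
          ((ContDiff.differentiable_iteratedFDeriv (f := fun y => F y z)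
            (by exact_mod_cast Nat.lt_of_succ_le hm') (h.contDiff z)) y).hasFDerivAt
    exact hderiv.differentiableAt

end Smooth

/-! ### The regulated form of BBS Corollary 7.5.4 -/

section Regulated

variable {E : Type*} [NormedAddCommGroup E] [NormedSpace ℝ E]
variable {A : Type*} [NormedRing A] [NormedAlgebra ℝ A] [CompleteSpace A]

/-- **Regulated `T_0`/`T_∞` control of `T_φ` (BBS Cor. 7.5.4 with a regulator).** Let `G : E → ℝ` be
monotone along rays, `G(tψ) ≤ G(ψ)` for `0 ≤ t ≤ 1`, and `‖F‖_{T_ψ(h)} ≤ A·G(ψ)` for all `ψ`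
(`A ≥ 0`). Then for `k < N` and `0 < ℓ ≤ h`,
`‖F‖_{T_φ(ℓ)} ≤ (1 + ‖φ‖/ℓ)^{k+1} (‖F‖_{T_0(ℓ)} + 2 (ℓ/h)^{k+1} A G(φ))`.
[cite: BauerschmidtBrydgesSlade2019RG, Corollary 7.5.4] -/
theorem tphiSeminorm_le_of_tzero_of_regulator (N : ℕ) {k : ℕ} (hk : k < N) {ℓ h : ℝ} (hℓ : 0 < ℓ)
    (hle : ℓ ≤ h) {F : E → A} (hF : ContDiff ℝ N F) {G : E → ℝ}
    (hG : ∀ ψ : E, ∀ t ∈ Icc (0 : ℝ) 1, G (t • ψ) ≤ G ψ) {Areg : ℝ} (hA : 0 ≤ Areg)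
    (hFA : ∀ ψ : E, tphiSeminorm N h F ψ ≤ Areg * G ψ) (φ : E) :
    tphiSeminorm N ℓ F φ ≤
      (1 + ‖φ‖ / ℓ) ^ (k + 1) * (tphiSeminorm N ℓ F 0 + 2 * (ℓ / h) ^ (k + 1) * (Areg * G φ)) := by
  have hP1 : 1 ≤ 1 + ‖φ‖ / ℓ := le_add_of_nonneg_right (div_nonneg (norm_nonneg _) hℓ.le)
  have hT : ContDiff ℝ N (taylorPolyFD k F) := taylorPolyFD_contDiff k F
  have hdecomp : F = fun x => taylorPolyFD k F x + (F x - taylorPolyFD k F x) := by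
    funext x; abel
  have h1 := tphiSeminorm_taylorPolyFD_le N hℓ F hk.le φ
  have h2 := tphiSeminorm_taylorRemainder_le N hk hℓ hle hF φ (Fbar := Areg * G φ)
    (fun t ht => (hFA _).trans (mul_le_mul_of_nonneg_left (hG φ t ht) hA))
  have h0 : 0 ≤ tphiSeminorm N ℓ F 0 := tphiSeminorm_nonneg N hℓ.le F 0
  have hPk : (1 + ‖φ‖ / ℓ) ^ k ≤ (1 + ‖φ‖ / ℓ) ^ (k + 1) := pow_le_pow_right₀ hP1 (Nat.le_succ k)
  calc tphiSeminorm N ℓ F φ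
      = tphiSeminorm N ℓ (fun x => taylorPolyFD k F x + (F x - taylorPolyFD k F x)) φ := by
        rw [← hdecomp]
    _ ≤ tphiSeminorm N ℓ (taylorPolyFD k F) φ + tphiSeminorm N ℓ (fun x => F x - taylorPolyFD k F x) φ :=
        tphiSeminorm_add_le N hℓ.le hT (hF.sub hT) φ
    _ ≤ tphiSeminorm N ℓ F 0 * (1 + ‖φ‖ / ℓ) ^ k +
          2 * (ℓ / h) ^ (k + 1) * (1 + ‖φ‖ / ℓ) ^ (k + 1) * (Areg * G φ) := add_le_add h1 h2
    _ ≤ tphiSeminorm N ℓ F 0 * (1 + ‖φ‖ / ℓ) ^ (k + 1) +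
          2 * (ℓ / h) ^ (k + 1) * (1 + ‖φ‖ / ℓ) ^ (k + 1) * (Areg * G φ) := by gcongr
    _ = (1 + ‖φ‖ / ℓ) ^ (k + 1) * (tphiSeminorm N ℓ F 0 + 2 * (ℓ / h) ^ (k + 1) * (Areg * G φ)) := by ring

end Regulated

/-! ### Gaussian regulators on Euclidean space -/

section Gaussian

variable {ι : Type*} [Fintype ι] [DecidableEq ι]
variable {A : Type*} [NormedRing A] [NormedAlgebra ℝ A]
variable {S M : Matrix ι ι ℝ}

omit [DecidableEq ι] in
/-- A positive semidefinite Gaussian regulator is monotone along rays: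
`e^{½ (tψ)ᵀM(tψ)} ≤ e^{½ ψᵀMψ}` for `0 ≤ t ≤ 1`, `M ⪰ 0`. [folklore] -/
theorem exp_half_quadratic_smul_le (hM : M.PosSemidef) (ψ : EuclideanSpace ℝ ι) {t : ℝ} (ht : t ∈ Icc (0 : ℝ) 1) :
    Real.exp ((ofLp (t • ψ) ⬝ᵥ M *ᵥ ofLp (t • ψ)) / 2) ≤ Real.exp ((ofLp ψ ⬝ᵥ M *ᵥ ofLp ψ) / 2) := by
  have hq : 0 ≤ ofLp ψ ⬝ᵥ M *ᵥ ofLp ψ := by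
    have h := hM.dotProduct_mulVec_nonneg (ofLp ψ)
    rwa [star_trivial] at h
  have ht2 : t * t ≤ 1 := by nlinarith [ht.1, ht.2]
  refine Real.exp_le_exp.2 (div_le_div_of_nonneg_right ?_ zero_le_two)
  rw [WithLp.ofLp_smul, mulVec_smul, dotProduct_smul, smul_dotProduct, smul_eq_mul, smul_eq_mul, ← mul_assoc]
  calc t * t * (ofLp ψ ⬝ᵥ M *ᵥ ofLp ψ) ≤ 1 * (ofLp ψ ⬝ᵥ M *ᵥ ofLp ψ) := by gcongr
    _ = _ := one_mul _

/-- **Margin adapter.** The additive margin `(1−ε)·1 − √S M √S ⪰ 0` with `ε > 0`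
(`RegulatorSubcriticality.regulator_step_margin`) gives the multiplicative margin
`1 − √S((1+ε)M)√S ≻ 0` (indeed `= ε²·1 + (1+ε)((1−ε)·1 − √S M √S)`). [folklore] -/
theorem posDef_one_sub_sqrt_smul_mul_sqrt_of_margin [Nonempty ι] {ε : ℝ} (hε : 0 < ε)
    (hle : ((1 - ε) • (1 : Matrix ι ι ℝ) - CFC.sqrt S * M * CFC.sqrt S).PosSemidef) :
    (1 - CFC.sqrt S * ((1 + ε) • M) * CFC.sqrt S).PosDef := by
  have hdec : 1 - CFC.sqrt S * ((1 + ε) • M) * CFC.sqrt S =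
      (ε ^ 2) • (1 : Matrix ι ι ℝ) + (1 + ε) • ((1 - ε) • (1 : Matrix ι ι ℝ) - CFC.sqrt S * M * CFC.sqrt S) := by
    rw [Matrix.mul_smul, Matrix.smul_mul, smul_sub, smul_smul]
    ext i j
    simp only [Matrix.sub_apply, Matrix.add_apply, Matrix.smul_apply, Matrix.one_apply, smul_eq_mul]
    split_ifs <;> ring
  rw [hdec]
  refine Matrix.PosDef.add_posSemidef ?_ (hle.smul (by linarith))
  exact (Matrix.PosDef.one.smul (by positivity))

/-- **The renormalised regulator is positive semidefinite**: for `S, M ⪰ 0` with `1 − √S M √S ≻ 0`,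
`M₊ = M(1 − SM)⁻¹ ⪰ 0` (from `RegulatorSubcriticality.regulator_step`). [folklore] -/
theorem posSemidef_renormalisedRegulator (hS : S.PosSemidef) (hM : M.PosSemidef)
    (hsub : (1 - CFC.sqrt S * M * CFC.sqrt S).PosDef) : (M * (1 - S * M)⁻¹).PosSemidef := by
  have h : (1 - CFC.sqrt (S + 0) * M * CFC.sqrt (S + 0)).PosDef := by rwa [add_zero]
  obtain ⟨-, -, hc, -⟩ := regulator_step hS Matrix.PosSemidef.zero hM h
  exact hc

variable [CompleteSpace A]

/-- **The Gaussian convolution of a regulator-bounded `C^N` functional is `C^N`.** [cite: BauerschmidtBrydgesSlade2019RG, Prop. 7.3.1] -/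
theorem contDiff_gaussian_convolution (N : ℕ) {𝔥 : ℝ} (h𝔥 : 0 < 𝔥) (hM : M.PosSemidef) {t : ℝ} (ht : 1 < t)
    (hsub : (1 - CFC.sqrt S * (t • M) * CFC.sqrt S).PosDef) {F : EuclideanSpace ℝ ι → A}
    (hF : ContDiff ℝ N F) {Areg : ℝ}
    (hFA : ∀ x, tphiSeminorm N 𝔥 F x ≤ Areg * Real.exp ((ofLp x ⬝ᵥ M *ᵥ ofLp x) / 2)) :
    ContDiff ℝ N (fun y : EuclideanSpace ℝ ι => ∫ ζ, F (y + ζ) ∂(multivariateGaussian 0 S)) :=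
  (derivDominated_shift_gaussian_of_tphiSeminorm_le N h𝔥 hM ht hsub hF hFA).contDiff_integral

/-- **Taylor-remainder contraction after the fluctuation integral** ("crucial contraction").
Let `S ⪰ 0`, `M ⪰ 0` with a margin `t > 1`, `1 − √S(tM)√S ≻ 0`; `F : ℝ^ι → A` of class `C^N` with
`‖F‖_{T_x(𝔥)} ≤ A e^{½ xᵀMx}`; `k < N` and `0 < ℓ ≤ 𝔥`. With `𝔼θF = ∫ F(· + ζ) N(0,S)(dζ)` and
`M₊ = M(1 − SM)⁻¹`,

  `‖(1 − Tay_k)𝔼θF‖_{T_φ(ℓ)} ≤ 2 (ℓ/𝔥)^{k+1} (1 + ‖φ‖/ℓ)^{k+1} · A e^{½ φᵀM₊φ} / √det(1 − SM)`.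

[cite: BauerschmidtBrydgesSlade2019RG, Lemma 7.5.3 with Prop. 7.3.1] -/
theorem tphiSeminorm_taylorRemainder_gaussian_convolution_le (N : ℕ) {k : ℕ} (hk : k < N)
    {ℓ 𝔥 : ℝ} (hℓ : 0 < ℓ) (hle : ℓ ≤ 𝔥) (hS : S.PosSemidef) (hM : M.PosSemidef) {t : ℝ} (ht : 1 < t)
    (hsub : (1 - CFC.sqrt S * (t • M) * CFC.sqrt S).PosDef) {F : EuclideanSpace ℝ ι → A}
    (hF : ContDiff ℝ N F) {Areg : ℝ}
    (hFA : ∀ x, tphiSeminorm N 𝔥 F x ≤ Areg * Real.exp ((ofLp x ⬝ᵥ M *ᵥ ofLp x) / 2))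
    (φ : EuclideanSpace ℝ ι) :
    tphiSeminorm N ℓ (fun y => (∫ ζ, F (y + ζ) ∂(multivariateGaussian 0 S)) -
        taylorPolyFD k (fun y => ∫ ζ, F (y + ζ) ∂(multivariateGaussian 0 S)) y) φ ≤
      2 * (ℓ / 𝔥) ^ (k + 1) * (1 + ‖φ‖ / ℓ) ^ (k + 1) *
        (Areg * (Real.exp ((ofLp φ ⬝ᵥ (M * (1 - S * M)⁻¹) *ᵥ ofLp φ) / 2) / Real.sqrt (1 - S * M).det)) := by
  have h𝔥 : 0 < 𝔥 := lt_of_lt_of_le hℓ hle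
  have hA0 : 0 ≤ Areg := by
    have h := (tphiSeminorm_nonneg N h𝔥.le F 0).trans (hFA 0)
    simp only [ofLp_zero, zero_dotProduct, zero_div, Real.exp_zero, mul_one] at h
    exact h
  have hsub1 : (1 - CFC.sqrt S * M * CFC.sqrt S).PosDef := posDef_one_sub_sqrt_mul_sqrt_of_margin hM ht.le hsub
  have hMplus : (M * (1 - S * M)⁻¹).PosSemidef := posSemidef_renormalisedRegulator hS hM hsub1
  have hdet : 0 < Real.sqrt (1 - S * M).det := Real.sqrt_pos.2 (det_one_sub_mul_pos_of_posDef hS hsub1)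
  have hE : ContDiff ℝ N (fun y : EuclideanSpace ℝ ι => ∫ ζ, F (y + ζ) ∂(multivariateGaussian 0 S)) :=
    contDiff_gaussian_convolution N h𝔥 hM ht hsub hF hFA
  refine tphiSeminorm_taylorRemainder_le N hk hℓ hle hE φ fun s hs => ?_
  refine (tphiSeminorm_gaussian_convolution_le N h𝔥 hS hM ht hsub hF hFA (s • φ)).trans ?_
  have hmono := exp_half_quadratic_smul_le hMplus φ hs
  gcongr

/-- **Regulated control of `𝔼θF` at the smaller field unit**: for `k < N`, `0 < ℓ ≤ 𝔥`,
`‖𝔼θF‖_{T_φ(ℓ)} ≤ (1 + ‖φ‖/ℓ)^{k+1} (‖𝔼θF‖_{T_0(ℓ)} + 2 (ℓ/𝔥)^{k+1} A e^{½φᵀM₊φ}/√det(1 − SM))`.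
[cite: BauerschmidtBrydgesSlade2019RG, Corollary 7.5.4 with Prop. 7.3.1] -/
theorem tphiSeminorm_gaussian_convolution_le_of_tzero (N : ℕ) {k : ℕ} (hk : k < N)
    {ℓ 𝔥 : ℝ} (hℓ : 0 < ℓ) (hle : ℓ ≤ 𝔥) (hS : S.PosSemidef) (hM : M.PosSemidef) {t : ℝ} (ht : 1 < t)
    (hsub : (1 - CFC.sqrt S * (t • M) * CFC.sqrt S).PosDef) {F : EuclideanSpace ℝ ι → A}
    (hF : ContDiff ℝ N F) {Areg : ℝ}
    (hFA : ∀ x, tphiSeminorm N 𝔥 F x ≤ Areg * Real.exp ((ofLp x ⬝ᵥ M *ᵥ ofLp x) / 2))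
    (φ : EuclideanSpace ℝ ι) :
    tphiSeminorm N ℓ (fun y => ∫ ζ, F (y + ζ) ∂(multivariateGaussian 0 S)) φ ≤
      (1 + ‖φ‖ / ℓ) ^ (k + 1) *
        (tphiSeminorm N ℓ (fun y => ∫ ζ, F (y + ζ) ∂(multivariateGaussian 0 S)) 0 +
          2 * (ℓ / 𝔥) ^ (k + 1) * (Areg / Real.sqrt (1 - S * M).det *
            Real.exp ((ofLp φ ⬝ᵥ (M * (1 - S * M)⁻¹) *ᵥ ofLp φ) / 2))) := by
  have h𝔥 : 0 < 𝔥 := lt_of_lt_of_le hℓ hle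
  have hA0 : 0 ≤ Areg := by
    have h := (tphiSeminorm_nonneg N h𝔥.le F 0).trans (hFA 0)
    simp only [ofLp_zero, zero_dotProduct, zero_div, Real.exp_zero, mul_one] at h
    exact h
  have hsub1 : (1 - CFC.sqrt S * M * CFC.sqrt S).PosDef := posDef_one_sub_sqrt_mul_sqrt_of_margin hM ht.le hsub
  have hMplus : (M * (1 - S * M)⁻¹).PosSemidef := posSemidef_renormalisedRegulator hS hM hsub1
  have hdet : 0 < Real.sqrt (1 - S * M).det := Real.sqrt_pos.2 (det_one_sub_mul_pos_of_posDef hS hsub1)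
  have hE : ContDiff ℝ N (fun y : EuclideanSpace ℝ ι => ∫ ζ, F (y + ζ) ∂(multivariateGaussian 0 S)) :=
    contDiff_gaussian_convolution N h𝔥 hM ht hsub hF hFA
  refine tphiSeminorm_le_of_tzero_of_regulator N hk hℓ hle hE
    (G := fun ψ => Real.exp ((ofLp ψ ⬝ᵥ (M * (1 - S * M)⁻¹) *ᵥ ofLp ψ) / 2))
    (fun ψ s hs => exp_half_quadratic_smul_le hMplus ψ hs) (div_nonneg hA0 hdet.le) (fun ψ => ?_) φ
  have h := tphiSeminorm_gaussian_convolution_le N h𝔥 hS hM ht hsub hF hFA ψ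
  calc _ ≤ _ := h
    _ = _ := by ring

/-! ### Absorbing polynomial field weights into a Gaussian regulator margin -/

omit [Fintype ι] [DecidableEq ι] in
/-- **Polynomial weights against a Gaussian**: `(1+u)ⁿ e^{−a u²} ≤ e^{n²/(4a)}` for `u ≥ 0`, `a > 0`
(`1 + u ≤ eᵘ` and completing the square) — the elementary step by which the factor
`P_𝔥(φ)^{k+1}` of the Taylor-remainder estimate is absorbed by a small part of the regulator margin.
[folklore] -/
theorem one_add_pow_mul_exp_neg_mul_sq_le (n : ℕ) {a u : ℝ} (ha : 0 < a) (hu : 0 ≤ u) :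
    (1 + u) ^ n * Real.exp (-(a * u ^ 2)) ≤ Real.exp ((n : ℝ) ^ 2 / (4 * a)) := by
  have h1 : (1 + u) ^ n ≤ Real.exp (n * u) := by
    calc (1 + u) ^ n ≤ (Real.exp u) ^ n :=
          pow_le_pow_left₀ (by linarith) (by linarith [Real.add_one_le_exp u]) n
      _ = Real.exp (n * u) := by rw [← Real.exp_nat_mul]
  have hsq : (n : ℝ) * u + -(a * u ^ 2) ≤ (n : ℝ) ^ 2 / (4 * a) := by
    have hid : (n : ℝ) ^ 2 / (4 * a) - ((n : ℝ) * u + -(a * u ^ 2)) = a * (u - n / (2 * a)) ^ 2 := by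
      field_simp
      ring
    nlinarith [mul_nonneg ha.le (sq_nonneg (u - n / (2 * a))), hid]
  calc (1 + u) ^ n * Real.exp (-(a * u ^ 2)) ≤ Real.exp (n * u) * Real.exp (-(a * u ^ 2)) := by
        gcongr
    _ = Real.exp ((n : ℝ) * u + -(a * u ^ 2)) := by rw [← Real.exp_add]
    _ ≤ Real.exp ((n : ℝ) ^ 2 / (4 * a)) := Real.exp_le_exp.2 hsq

omit [DecidableEq ι] in
/-- **Absorbing `P_𝔥(φ)ⁿ` into a regulator margin**: if the quadratic form of `M` is coercive,
`φᵀMφ ≥ m‖φ‖²` (`m > 0`), then for every `δ > 0`,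
`(1 + ‖φ‖/𝔥)ⁿ e^{−(δ/2) φᵀMφ} ≤ e^{n²/(2 δ m 𝔥²)}`; hence `Pⁿ e^{½φᵀMφ} ≤ e^{n²/(2δm𝔥²)} e^{½φᵀ(1+δ)Mφ}`.
[folklore] -/
theorem one_add_norm_div_pow_mul_exp_neg_le {M : Matrix ι ι ℝ} {m : ℝ} (hm : 0 < m)
    (hcoer : ∀ φ : EuclideanSpace ℝ ι, m * ‖φ‖ ^ 2 ≤ ofLp φ ⬝ᵥ M *ᵥ ofLp φ) (n : ℕ) {𝔥 δ : ℝ}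
    (h𝔥 : 0 < 𝔥) (hδ : 0 < δ) (φ : EuclideanSpace ℝ ι) :
    (1 + ‖φ‖ / 𝔥) ^ n * Real.exp (-(δ / 2) * (ofLp φ ⬝ᵥ M *ᵥ ofLp φ)) ≤
      Real.exp ((n : ℝ) ^ 2 / (2 * δ * m * 𝔥 ^ 2)) := by
  have ha : 0 < δ * m * 𝔥 ^ 2 / 2 := by positivity
  have hu : 0 ≤ ‖φ‖ / 𝔥 := div_nonneg (norm_nonneg _) h𝔥.le
  have h1 := one_add_pow_mul_exp_neg_mul_sq_le n ha hu
  have hexp : Real.exp (-(δ / 2) * (ofLp φ ⬝ᵥ M *ᵥ ofLp φ)) ≤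
      Real.exp (-(δ * m * 𝔥 ^ 2 / 2 * (‖φ‖ / 𝔥) ^ 2)) := by
    refine Real.exp_le_exp.2 ?_
    have h2 : δ * m * 𝔥 ^ 2 / 2 * (‖φ‖ / 𝔥) ^ 2 = (δ / 2) * (m * ‖φ‖ ^ 2) := by
      field_simp
    rw [h2]
    nlinarith [hcoer φ, hδ]
  have hconst : ((n : ℝ) ^ 2 / (4 * (δ * m * 𝔥 ^ 2 / 2))) = (n : ℝ) ^ 2 / (2 * δ * m * 𝔥 ^ 2) := by
    field_simp
    ring
  calc (1 + ‖φ‖ / 𝔥) ^ n * Real.exp (-(δ / 2) * (ofLp φ ⬝ᵥ M *ᵥ ofLp φ))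
      ≤ (1 + ‖φ‖ / 𝔥) ^ n * Real.exp (-(δ * m * 𝔥 ^ 2 / 2 * (‖φ‖ / 𝔥) ^ 2)) := by gcongr
    _ ≤ Real.exp ((n : ℝ) ^ 2 / (4 * (δ * m * 𝔥 ^ 2 / 2))) := h1
    _ = Real.exp ((n : ℝ) ^ 2 / (2 * δ * m * 𝔥 ^ 2)) := by rw [hconst]

end Gaussian

end Literature.MathematicalPhysics.QuantumFieldTheory

end
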